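import Literature.MathematicalPhysics.QuantumFieldTheory.Balaban1983to89.B9Thm31SiteGpDecayReg335Y
import Literature.MathematicalPhysics.QuantumFieldTheory.Balaban1983to89.B4Cor23Region

/-!
# `Balaban1983to89.B9Thm31SiteAgmonWeightY` — T. Bałaban, *Propagators for lattice gauge theories in a background field*, Commun. Math. Phys. **99**
# (1985) 389–434 [Balaban1985BackgroundPropagators] Thm 3.1 (3.46) p. 398, with S. Agmon's positive-weight method [Agmon1982]: ★★★ **THE EXPONENTIAL
# WEIGHT `ω = e^{δρ}` — for any site function `ρ` vanishing on `supp λ`, `L^{−lev}`-Lipschitz across bonds and of oscillation `≤ D` on the blocks of `𝔅`,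
# and `δ² (2(d+1) + D²) ≤ 1∕16`: `Σ_{z∈A} HS((G′(U)λ)(z)) ≤ 256·(L^{j_A})²(L^{j_B})²·e^{−2δ·ρ_A}·‖λ‖²₁` on the (3.35) class** — print's (3.46a)
# `‖hG′(U)λ‖ ≤ B₀(Lʲη)(Lʲ′η)e^{−δ₀d(y,y′)}‖h‖‖λ‖` with `B₀ = 16`, `δ₀ = 1∕(4(d+2))` for `D = d+1` (file 7 of the site-coercivity set of width seat `pub-ymgap-dag-n06-w1`)

statement-level skeleton of published theorems with citation tags; proofs where landed; nothing here is a claim about the Yang–Mills mass gap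

THE PRINT (p. 398, verbatim).  *«Finally, we have the inequalities in L₂-norms ‖hG′(U)λ‖, … ≤ B₀(Lʲη)(Lʲ′η)e^{−δ₀d(y,y′)}‖h‖‖λ‖ for supp h ⊂ Δ̃(y), y ∈ Λ_j,
supp λ ⊂ Δ̃(y′); (3.46)»*; p. 397: *«we will use the weighted distance d(y,y′) defined by (2.36) in [4]»* — a path length in which a step inside `Ω_j∖Ω_{j+1}`
costs `(Lʲη)⁻¹` per `η`, i.e. lengths in units of the local block scale.

WHY THIS FILE.  File 6 (`B9Thm31SiteGpDecayReg335Y.hs_restrict_GpY_parSymY_le`) proved the Agmon bound for def-Y's `G′(U) = GpY i (parSymY i) U` on the class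
for an ABSTRACT weight `ω` (bond ratios `q ≤ θ_b·(L^{lev})⁻²`, block oscillation `q ≤ θ_s`, `(d+1)θ_b + θ_s∕2 ≤ 1∕16`).  Here `ω := e^{δρ}`: the ratio defect is
`q(e^{δa}, e^{δb}) = e^{δ(a−b)} + e^{−δ(a−b)} − 2 ≤ 2δ²(a−b)²` for `|δ(a−b)| ≤ 1` (Mathlib's `|eˣ − 1 − x| ≤ x²`), so a site function `ρ` with
`|ρ(z+e_μ) − ρ(z)| ≤ (L^{lev})⁻¹` at both ends of every bond and `|ρ z − ρ w| ≤ D` on every block of `𝔅` yields `θ_b = 2δ²`, `θ_s = 2δ²D²`, and the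
bound of file 6 reads `Σ_{z∈A}HS((G′λ)(z)) ≤ 256·(L^{j_A})²(L^{j_B})²·e^{−2δr}·‖λ‖²₁` whenever `ρ = 0` on `B ⊇ supp λ` and `ρ ≥ r` on `A` — for instance
`ρ :=` print's weighted distance to `supp λ` (whose two Lipschitz properties over `{Ω_j}` are a geometric fact NOT proved here; `ρ` stays a parameter).

WHAT IS PROVED (sorry-free; 0 `def`; nothing of [B9] asserted beyond what is proved).
* §1 `q_exp_eq`, ★ `q_exp_le` (with the tree's `B4Cor23Region.exp_add_exp_neg_sub_two_le`: `eˣ + e⁻ˣ − 2 ≤ 2x²` for `|x| ≤ 1`) (`q(e^{δa}, e^{δb}) ≤ 2δ²t²` if `|a − b| ≤ t`, `δt ≤ 1`).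
* §2 ★ `bondRatio_exp_le ∕ bondRatio_exp_le'`, ★ `blockOsc_exp_le` — the weight `z ↦ e^{δρ z}` meets file 6's hypotheses with `θ_b = 2δ²`, `θ_s = 2δ²D²`.
* §3 ★★★ **`hs_restrict_GpY_parSymY_le_exp`** (the bound with `W = e^{δr}` under `δ²(2(d+1) + D²) ≤ 1∕16`, `0 ≤ δ ≤ 1`, `δD ≤ 1`) and ★★★
  **`hs_restrict_GpY_parSymY_le_exp_canonical`** (`D = d+1`, `δ = 1∕(4(d+2))`: `Σ_{z∈A}HS((G′(U)λ)(z)) ≤ 256·(L^{j_A})²(L^{j_B})²·(e^{r∕(4(d+2))})⁻²·‖λ‖²₁`).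
MODEL ∕ DECLARED READINGS.  As file 6; (M4′) the Agmon exponent `ρ` is any site function with the two stated Lipschitz properties and `ρ = 0` on the support
set `B`; print's `d(y,y′)` enters only through `r ≤ inf_A ρ`.  NON-VACUITY (A6): `ρ ≡ 0` is admissible (then `r ≤ 0`, the bound is file 4's localised); for
`B = ∅` the statement is about `λ = 0`; non-trivial admissible `ρ` exist on every member (e.g. `(L^k)⁻¹·`(graph distance to `B`) truncated at `1`, oscillation
`≤ 1 ≤ D`) — the sharp multi-scale `ρ` is the consumer's geometric input.  NOT HERE: (3.42)–(3.45), (3.46)'s derivative companions, (3.47), the bond sector.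
HONEST SCOPE.  Elementary real analysis on top of file 6; NOT a node discharge, NOT summit progress; count-neutral; nothing continuum ∕ OS ∕ mass gap ∕ Clay.
NEW file importing file 6 and `B4Cor23Region` (for `exp_add_exp_neg_sub_two_le`) only; nothing landed is modified.  Net new unproved facts: 0.
-/

noncomputable section

namespace Literature.MathematicalPhysics.QuantumFieldTheory.Balaban1983to89.B9Thm31SiteAgmonWeightY

open Literature.MathematicalPhysics.QuantumFieldTheory.Balaban1983to89
open Node00 B6KLevelCensusIndexV1 B6Geom246MultiLevelBox B6MultiLevelBoxOperator B6MultiLevelTorusOperator B6GlobalChartV1 B9BackgroundsKLevelV1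
  B9Eq39Adjoint B9Thm311ReadingCoords B9Thm311DeltaPrimePos B9Ineq369CurvatureSmallAtLettersY B9Thm31SiteCoerciveGaugeBlockY
  B9Thm31SiteCoerciveReg335Y B9Thm31SiteGpBoundsReg335Y B9Thm31SitePolarisedFormY B9Thm31SiteConjugatedFormY B9Thm31SiteGpDecayReg335Y
open Literature.MathematicalPhysics.QuantumFieldTheory.Balaban1983to89.B4Cor23Region (exp_add_exp_neg_sub_two_le)
open scoped Matrix Matrix.Norms.L2Operator

/-! ## §1 The ratio defect of an exponential weight -/

section Scalar

/-- the ratio defect of an exponential weight depends on the difference only: `q(e^{a}, e^{b}) = e^{a−b} + e^{−(a−b)} − 2`. [cite: Agmon1982, Ch.1, bookkeeping] -/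
theorem q_exp_eq (a b : ℝ) : Real.exp a / Real.exp b + Real.exp b / Real.exp a - 2 = Real.exp (a - b) + Real.exp (-(a - b)) - 2 := by
  rw [← Real.exp_sub, ← Real.exp_sub, neg_sub]

/-- ★ `q(e^{δa}, e^{δb}) ≤ 2δ²t²` whenever `|a − b| ≤ t` and `δt ≤ 1`, `δ ≥ 0`. [cite: Agmon1982, Ch.1 (the weight e^{δρ}), bookkeeping] -/
theorem q_exp_le {δ a b t : ℝ} (hδ : 0 ≤ δ) (hab : |a - b| ≤ t) (hδt : δ * t ≤ 1) :
    Real.exp (δ * a) / Real.exp (δ * b) + Real.exp (δ * b) / Real.exp (δ * a) - 2 ≤ 2 * δ ^ 2 * t ^ 2 := by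
  rw [q_exp_eq, ← mul_sub]
  have ht : 0 ≤ t := le_trans (abs_nonneg _) hab
  have hx : |δ * (a - b)| ≤ δ * t := by rw [abs_mul, abs_of_nonneg hδ]; exact mul_le_mul_of_nonneg_left hab hδ
  have h := exp_add_exp_neg_sub_two_le (hx.trans hδt)
  have hsq : (δ * (a - b)) ^ 2 ≤ (δ * t) ^ 2 := by
    rw [← sq_abs (δ * (a - b))]
    exact pow_le_pow_left₀ (abs_nonneg _) hx 2
  nlinarith

end Scalar

/-! ## §2 The exponential weight meets file 6's hypotheses -/

section Weight

variable {d ℓ : ℕ} {hd : 1 ≤ d + 1} {hL : Odd (ℓ + 1) ∧ 1 < ℓ + 1} {b₀ b₁ : ℝ}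
variable (i : KIdx d ℓ hd hL b₀ b₁)

/-- ★ BOND RATIOS OF `e^{δρ}` AT THE SOURCE END: if `|ρ(z+e_μ) − ρ(z)| ≤ (L^{lev z})⁻¹` then `q(ω(z+e_μ), ω z) ≤ 2δ²·(L^{lev z})⁻²` (`0 ≤ δ ≤ 1`).
[cite: Agmon1982, Ch.1; Balaban1985BackgroundPropagators, p.397 (weighted distance: steps in units of Lʲη)] -/
theorem bondRatio_exp_le {δ : ℝ} (hδ0 : 0 ≤ δ) (hδ1 : δ ≤ 1) {ρ : SiteY i → ℝ} (μ : Fin (d + 1)) (z : SiteY i)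
    (hρ : |ρ (shiftY i μ z) - ρ z| ≤ ((((ℓ + 1) ^ (blkOf i.D.toDomains z).1.1 : ℕ) : ℝ))⁻¹) :
    Real.exp (δ * ρ (shiftY i μ z)) / Real.exp (δ * ρ z) + Real.exp (δ * ρ z) / Real.exp (δ * ρ (shiftY i μ z)) - 2
      ≤ 2 * δ ^ 2 * (((((ℓ + 1) ^ (blkOf i.D.toDomains z).1.1 : ℕ) : ℝ)) ^ 2)⁻¹ := by
  have hn1 : (1 : ℝ) ≤ (((ℓ + 1) ^ (blkOf i.D.toDomains z).1.1 : ℕ) : ℝ) := by exact_mod_cast Nat.one_le_pow _ _ (Nat.succ_pos ℓ)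
  have ht1 : ((((ℓ + 1) ^ (blkOf i.D.toDomains z).1.1 : ℕ) : ℝ))⁻¹ ≤ 1 := inv_le_one_of_one_le₀ hn1
  have hδt : δ * ((((ℓ + 1) ^ (blkOf i.D.toDomains z).1.1 : ℕ) : ℝ))⁻¹ ≤ 1 := by nlinarith [inv_nonneg.2 (le_trans zero_le_one hn1)]
  have h := q_exp_le hδ0 hρ hδt
  rwa [inv_pow] at h

/-- ★ BOND RATIOS OF `e^{δρ}` AT THE TARGET END: the same with the target's level. [cite: Agmon1982, Ch.1; Balaban1985BackgroundPropagators, p.397] -/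
theorem bondRatio_exp_le' {δ : ℝ} (hδ0 : 0 ≤ δ) (hδ1 : δ ≤ 1) {ρ : SiteY i → ℝ} (μ : Fin (d + 1)) (z : SiteY i)
    (hρ : |ρ (shiftY i μ z) - ρ z| ≤ ((((ℓ + 1) ^ (blkOf i.D.toDomains (shiftY i μ z)).1.1 : ℕ) : ℝ))⁻¹) :
    Real.exp (δ * ρ (shiftY i μ z)) / Real.exp (δ * ρ z) + Real.exp (δ * ρ z) / Real.exp (δ * ρ (shiftY i μ z)) - 2
      ≤ 2 * δ ^ 2 * (((((ℓ + 1) ^ (blkOf i.D.toDomains (shiftY i μ z)).1.1 : ℕ) : ℝ)) ^ 2)⁻¹ := by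
  have hn1 : (1 : ℝ) ≤ (((ℓ + 1) ^ (blkOf i.D.toDomains (shiftY i μ z)).1.1 : ℕ) : ℝ) := by exact_mod_cast Nat.one_le_pow _ _ (Nat.succ_pos ℓ)
  have ht1 : ((((ℓ + 1) ^ (blkOf i.D.toDomains (shiftY i μ z)).1.1 : ℕ) : ℝ))⁻¹ ≤ 1 := inv_le_one_of_one_le₀ hn1
  have hδt : δ * ((((ℓ + 1) ^ (blkOf i.D.toDomains (shiftY i μ z)).1.1 : ℕ) : ℝ))⁻¹ ≤ 1 := by nlinarith [inv_nonneg.2 (le_trans zero_le_one hn1)]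
  have h := q_exp_le hδ0 hρ hδt
  rwa [inv_pow] at h

/-- ★ BLOCK OSCILLATION OF `e^{δρ}`: if `|ρ z − ρ w| ≤ D` and `δD ≤ 1` then `q(ω z, ω w) ≤ 2δ²D²`. [cite: Agmon1982, Ch.1; Balaban1984PropagatorsII, (2.3)–(2.4) p.224] -/
theorem blockOsc_exp_le {δ D : ℝ} (hδ0 : 0 ≤ δ) (hδD : δ * D ≤ 1) {ρ : SiteY i → ℝ} (z w : SiteY i) (hρ : |ρ z - ρ w| ≤ D) :
    Real.exp (δ * ρ z) / Real.exp (δ * ρ w) + Real.exp (δ * ρ w) / Real.exp (δ * ρ z) - 2 ≤ 2 * δ ^ 2 * D ^ 2 :=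
  q_exp_le hδ0 hρ hδD

end Weight

/-! ## §3 (3.46a) with the exponential weight -/

section Main

variable {d ℓ : ℕ} {hd : 1 ≤ d + 1} {hL : Odd (ℓ + 1) ∧ 1 < ℓ + 1} {b₀ b₁ : ℝ}
variable (i : KIdx d ℓ hd hL b₀ b₁) {N : ℕ} {G : Subgroup (Matrix (Fin N) (Fin N) ℂ)ˣ}

/-- ★★★ **(3.46a) FOR `G′(U)` ON THE CLASS WITH THE AGMON WEIGHT `e^{δρ}`.**  `G ≤ U(N)`, `N ≥ 1`, `0 ≤ c·M·α₀`, `c·M·α₀·(d+1) ≤ 1∕16`,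
`U ∈ (bg9K (M_N ℂ) G i).Reg335 c α₀`; `0 ≤ δ ≤ 1`, `δD ≤ 1`, `δ²(2(d+1) + D²) ≤ 1∕16`; a site function `ρ` with `|ρ(z+e_μ) − ρ z| ≤ (L^{lev})⁻¹` at both ends
of every bond and `|ρ z − ρ w| ≤ D` on every block of `𝔅`; finite site sets `A, B` with `ρ = 0` on `B`, `ρ ≥ r` on `A`, levels `≤ j_A` on `A`, `≤ j_B` on `B`;
`λ` vanishing off `B`.  THEN `Σ_{z∈A} HS((G′(U)λ)(z)) ≤ 256·((L^{j_A})²(L^{j_B})²∕(e^{δr})²)·‖λ‖²₁`.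
[cite: Balaban1985BackgroundPropagators, Thm 3.1 (3.46) p.398, (3.35) p.396; Agmon1982, Ch.1, Thm 1.5; CombesThomas1973] -/
theorem hs_restrict_GpY_parSymY_le_exp [Nonempty (Fin N)] (hG : G ≤ B7Prop2Explicit.unitaryUnits (Matrix (Fin N) (Fin N) ℂ))
    {U : CfgY (Matrix (Fin N) (Fin N) ℂ) i} {c α₀ : ℝ} (hC0 : 0 ≤ c * (kGeo i).M * α₀) (hC1 : c * (kGeo i).M * α₀ * ((d : ℝ) + 1) ≤ 1 / 16)
    (hreg : (bg9K (Matrix (Fin N) (Fin N) ℂ) G i).Reg335 c α₀ U) {δ D : ℝ} (hδ0 : 0 ≤ δ) (hδ1 : δ ≤ 1) (hδD : δ * D ≤ 1)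
    (hδκ : δ ^ 2 * (2 * ((d : ℝ) + 1) + D ^ 2) ≤ 1 / 16) {ρ : SiteY i → ℝ}
    (hρ1 : ∀ μ z, |ρ (shiftY i μ z) - ρ z| ≤ ((((ℓ + 1) ^ (blkOf i.D.toDomains z).1.1 : ℕ) : ℝ))⁻¹)
    (hρ2 : ∀ μ z, |ρ (shiftY i μ z) - ρ z| ≤ ((((ℓ + 1) ^ (blkOf i.D.toDomains (shiftY i μ z)).1.1 : ℕ) : ℝ))⁻¹)
    (hρD : ∀ z w : SiteY i, blkOf i.D.toDomains w = blkOf i.D.toDomains z → |ρ z - ρ w| ≤ D)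
    {A B : Finset (SiteY i)} {Ψ : SiteY i → Matrix (Fin N) (Fin N) ℂ} (hΨ : ∀ z, z ∉ B → Ψ z = 0) (hρB : ∀ z ∈ B, ρ z = 0)
    {jA jB : ℕ} (hjA : ∀ z ∈ A, (blkOf i.D.toDomains z).1.1 ≤ jA) (hjB : ∀ z ∈ B, (blkOf i.D.toDomains z).1.1 ≤ jB)
    {r : ℝ} (hr : ∀ z ∈ A, r ≤ ρ z) :
    ∑ z ∈ A, ∑ a, ∑ b, ‖GpY i (parSymY i) U Ψ z a b‖ ^ 2
      ≤ 256 * (((((ℓ + 1) ^ jA : ℕ) : ℝ)) ^ 2 * ((((ℓ + 1) ^ jB : ℕ) : ℝ)) ^ 2 / Real.exp (δ * r) ^ 2) * trIP (fun _ => (1 : ℝ)) Ψ Ψ := by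
  have hω : ∀ z, 0 < Real.exp (δ * ρ z) := fun z => Real.exp_pos _
  have hκ : ((d : ℝ) + 1) * (2 * δ ^ 2) + (2 * δ ^ 2 * D ^ 2) / 2 ≤ 1 / 16 := by nlinarith
  have hωB : ∀ z ∈ B, Real.exp (δ * ρ z) = 1 := fun z hz => by rw [hρB z hz, mul_zero, Real.exp_zero]
  have hW : ∀ z ∈ A, Real.exp (δ * r) ≤ Real.exp (δ * ρ z) := fun z hz => Real.exp_le_exp.2 (mul_le_mul_of_nonneg_left (hr z hz) hδ0)
  exact hs_restrict_GpY_parSymY_le i hG hC0 hC1 hreg hω (fun μ z => bondRatio_exp_le i hδ0 hδ1 μ z (hρ1 μ z))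
    (fun μ z => bondRatio_exp_le' i hδ0 hδ1 μ z (hρ2 μ z)) (fun z w hzw => blockOsc_exp_le i hδ0 hδD z w (hρD z w hzw)) hκ hΨ hωB hjA hjB
    (Real.exp_pos _) hW

/-- ★★★ **THE CANONICAL RATE**: with block oscillation `D = d+1` and `δ₀ := 1∕(4(d+2))` the smallness conditions hold (`(d+1)(d+3) ≤ (d+2)²`), so on the class
`Σ_{z∈A} HS((G′(U)λ)(z)) ≤ 256·((L^{j_A})²(L^{j_B})²∕(e^{δ₀r})²)·‖λ‖²₁` — `B₀ = 16`, `δ₀ = 1∕(4(d+2))`, free of the member, the volume, `k`, `N`, `U`.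
[cite: Balaban1985BackgroundPropagators, Thm 3.1 (3.46) p.398; Agmon1982, Ch.1, Thm 1.5] -/
theorem hs_restrict_GpY_parSymY_le_exp_canonical [Nonempty (Fin N)] (hG : G ≤ B7Prop2Explicit.unitaryUnits (Matrix (Fin N) (Fin N) ℂ))
    {U : CfgY (Matrix (Fin N) (Fin N) ℂ) i} {c α₀ : ℝ} (hC0 : 0 ≤ c * (kGeo i).M * α₀) (hC1 : c * (kGeo i).M * α₀ * ((d : ℝ) + 1) ≤ 1 / 16)
    (hreg : (bg9K (Matrix (Fin N) (Fin N) ℂ) G i).Reg335 c α₀ U) {ρ : SiteY i → ℝ}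
    (hρ1 : ∀ μ z, |ρ (shiftY i μ z) - ρ z| ≤ ((((ℓ + 1) ^ (blkOf i.D.toDomains z).1.1 : ℕ) : ℝ))⁻¹)
    (hρ2 : ∀ μ z, |ρ (shiftY i μ z) - ρ z| ≤ ((((ℓ + 1) ^ (blkOf i.D.toDomains (shiftY i μ z)).1.1 : ℕ) : ℝ))⁻¹)
    (hρD : ∀ z w : SiteY i, blkOf i.D.toDomains w = blkOf i.D.toDomains z → |ρ z - ρ w| ≤ (d : ℝ) + 1)
    {A B : Finset (SiteY i)} {Ψ : SiteY i → Matrix (Fin N) (Fin N) ℂ} (hΨ : ∀ z, z ∉ B → Ψ z = 0) (hρB : ∀ z ∈ B, ρ z = 0)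
    {jA jB : ℕ} (hjA : ∀ z ∈ A, (blkOf i.D.toDomains z).1.1 ≤ jA) (hjB : ∀ z ∈ B, (blkOf i.D.toDomains z).1.1 ≤ jB)
    {r : ℝ} (hr : ∀ z ∈ A, r ≤ ρ z) :
    ∑ z ∈ A, ∑ a, ∑ b, ‖GpY i (parSymY i) U Ψ z a b‖ ^ 2
      ≤ 256 * (((((ℓ + 1) ^ jA : ℕ) : ℝ)) ^ 2 * ((((ℓ + 1) ^ jB : ℕ) : ℝ)) ^ 2 / Real.exp ((1 / (4 * ((d : ℝ) + 2))) * r) ^ 2)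
          * trIP (fun _ => (1 : ℝ)) Ψ Ψ := by
  have hd0 : (0 : ℝ) ≤ d := Nat.cast_nonneg d
  have hd2 : (0 : ℝ) < 4 * ((d : ℝ) + 2) := by positivity
  have hδ0 : (0 : ℝ) ≤ 1 / (4 * ((d : ℝ) + 2)) := by positivity
  have hδ1 : 1 / (4 * ((d : ℝ) + 2)) ≤ 1 := by rw [div_le_one hd2]; linarith
  have hδD : 1 / (4 * ((d : ℝ) + 2)) * ((d : ℝ) + 1) ≤ 1 := by
    rw [div_mul_eq_mul_div, one_mul, div_le_one hd2]; linarith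
  have hδκ : (1 / (4 * ((d : ℝ) + 2))) ^ 2 * (2 * ((d : ℝ) + 1) + ((d : ℝ) + 1) ^ 2) ≤ 1 / 16 := by
    rw [div_pow, one_pow, mul_pow, one_div_mul_eq_div, div_le_iff₀ (by positivity)]
    nlinarith
  exact hs_restrict_GpY_parSymY_le_exp i hG hC0 hC1 hreg hδ0 hδ1 hδD hδκ hρ1 hρ2 hρD hΨ hρB hjA hjB hr

end Main

end Literature.MathematicalPhysics.QuantumFieldTheory.Balaban1983to89.B9Thm31SiteAgmonWeightY
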